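import Literature.NumberTheory.GaloisCohomology.PoitouTate
import Literature.NumberTheory.GaloisRepresentations.LocalGlobalCohomologyTateProofs
import Literature.NumberTheory.GaloisRepresentations.LocalGlobalCohomologyDualityProofs
import HarnessLib

/-!
# Poitou–Tate: the local-duality conjunct of the named fact is automatic

Topic `NumberTheory/GaloisCohomology`; namespace `Literature.NumberTheory.GaloisCohomology`.
Proof file (theorems only: no definition, no named fact, no instance; D-0026) of
`Literature/NumberTheory/GaloisCohomology/PoitouTate.lean`.

The named fact `poitouTate_sum_localTatePairing_eq_zero K` (Milne, *ADT*, I Thm. 4.10(b) with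
Cor. 2.3) asserts, for every `n ≥ 1`, the existence of a family of local invariant maps
`inv_v : H²(K_v, μₙ) →+ ℤ/n` which is (i) PERFECT at the finite places (`LocalInvariants.IsPerfect`:
`inv_v` bijective and both adjoints of `(x, y) ↦ inv_v (x ∪ y)` bijective for every finite
`n`-torsion `M`) and (ii) satisfies the Poitou–Tate vanishing `∑_v inv_v (loc_v x ∪ loc_v y) = 0`
(`LocalInvariants.SumLocalTermEqZero`).  This file proves that (i) carries no content beyond the
bijectivity of the `inv_v`:

* (private) `AddMonoidHom.zmod_apply_eq_mul` — an additive endomorphism `φ` of `ℤ/n` is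
  `x ↦ x · φ 1`; `AddMonoidHom.exists_eq_mul_of_bijective` — an additive map `g : A → ℤ/n` factors
  through a BIJECTIVE additive `f : A → ℤ/n` as `g = f · a` for a constant `a ∈ ℤ/n`;
* **`LocalInvariants.isPerfect_of_bijective`** — a family `inv` of local invariant maps whose
  members at the finite places are bijective is perfect: the tree's local Tate duality
  (`localTatePairingZMod_injective`, Milne I Cor. 2.3 / Serre II §5.2 Thm. 2, PROVED in
  `LocalGlobalCohomologyTateProofs`) provides at each finite `v` and each `M` SOME `inv₀` with
  both adjoints of `inv₀ (· ∪ ·)` injective; `inv₀ = inv_v · a`, so the adjoints of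
  `inv_v (· ∪ ·)` are injective too, hence bijective (finite groups killed by `n`,
  `AddMonoidHom.bijective_of_injective_of_injective_flip`);
* **`poitouTate_sum_localTatePairing_eq_zero_of_sumInvLocalizationEqZero`** — the named fact
  follows from the RECIPROCITY LAW OF THE BRAUER GROUP ALONE: for every `n ≥ 1`, a family of
  ISOMORPHISMS `inv_v : H²(K_v, μₙ) ⥲ ℤ/n` (finite `v`; anything at the infinite places) with
  `∑_v inv_v (loc_v c) = 0` on global classes `c ∈ H²(K, μₙ)` (`SumInvLocalizationEqZero`);
  and `poitouTate_sum_localTatePairing_eq_zero_of_sumLocalTermEqZero` (the same with the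
  cup-product form of the vanishing).

So what separates the tree from `poitouTate_sum_localTatePairing_eq_zero` is exactly the
Albert–Brauer–Hasse–Noether reciprocity `∑_v inv_v = 0` for ONE coherent normalisation of local
invariant isomorphisms (Harari Thm. 14.11 second half; Milne CFT VIII Thm. 4.2), and no local
duality statement.

## References
* J. S. Milne, *Arithmetic Duality Theorems*, 2nd ed. (2006), Ch. I, Cor. 2.3 and Thm. 4.10(b).
  [MilneADT2006]
* D. Harari, *Galois Cohomology and Class Field Theory*, Springer 2020, Prop. 8.13, Thm. 10.9,
  Thm. 14.11. [Harari2020]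
* J.-P. Serre, *Galois Cohomology*, Springer 1997, II §5.2 Thm. 2. [SerreGaloisCohomology1997]
-/

noncomputable section

open Function NumberField IsDedekindDomain
open scoped NumberField

universe u

/-! ### Additive maps into `ℤ/n` -/

/-- An additive endomorphism of `ℤ/n` is multiplication by its value at `1`: `φ x = x · φ 1`.
[folklore] -/
private theorem AddMonoidHom.zmod_apply_eq_mul {n : ℕ} [NeZero n] (φ : ZMod n →+ ZMod n) (x : ZMod n) :
    φ x = x * φ 1 := by
  conv_lhs => rw [← ZMod.natCast_zmod_val x, ← nsmul_one (x.val), map_nsmul]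
  rw [nsmul_eq_mul, ZMod.natCast_zmod_val]

/-- An additive map `g : A → ℤ/n` factors through a BIJECTIVE additive map `f : A → ℤ/n` as
`g = f · a` for a constant `a` (namely `a = (g ∘ f⁻¹)(1)`). [folklore] -/
private theorem AddMonoidHom.exists_eq_mul_of_bijective {A : Type*} [AddCommGroup A] {n : ℕ} [NeZero n]
    (f g : A →+ ZMod n) (hf : Bijective f) : ∃ a : ZMod n, ∀ x : A, g x = f x * a := by
  let e : A ≃+ ZMod n := AddEquiv.ofBijective f hf
  refine ⟨(g.comp e.symm.toAddMonoidHom) 1, fun x => ?_⟩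
  have h := AddMonoidHom.zmod_apply_eq_mul (g.comp e.symm.toAddMonoidHom) (e x)
  rw [AddMonoidHom.comp_apply] at h
  change g (e.symm (e x)) = _ at h
  rwa [e.symm_apply_apply] at h

namespace Literature.NumberTheory.GaloisCohomology

open Literature.NumberTheory.GaloisRepresentations
open Literature.NumberTheory.GaloisRepresentations.DiscreteGaloisModule (mu MuCarrier)

variable {K : Type u} [Field K] [NumberField K]

namespace LocalInvariants

/-! ### Perfectness is automatic -/

/-- **A family of local invariant maps which is bijective at the finite places is perfect.**  For
`inv : LocalInvariants K n` with every `inv_v : H²(K_v, μₙ) →+ ℤ/n` (`v` finite) bijective,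
`inv.IsPerfect` holds: for each finite `n`-torsion discrete `Γ_K`-module `M`, both adjoints of
`(x, y) ↦ inv_v (x ∪ y) : H¹(K_v, M) × H¹(K_v, M^D) → ℤ/n` are bijective.  Proof: local Tate
duality as PROVED in the tree (`localTatePairingZMod_injective`: for some `inv₀` both adjoints of
`inv₀ (· ∪ ·)` are injective); `inv₀ = inv_v · a` for a constant `a`
(`AddMonoidHom.exists_eq_mul_of_bijective`), so the adjoints for `inv_v` are injective, hence
bijective (`AddMonoidHom.bijective_of_injective_of_injective_flip`; both groups are finite and
killed by `n`). [cite: MilneADT2006, Ch. I, Cor. 2.3] [cite: SerreGaloisCohomology1997, II §5.2 Thm. 2] -/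
theorem isPerfect_of_bijective {n : ℕ} [NeZero n] (inv : LocalInvariants K n)
    (h : ∀ v : HeightOneSpectrum (𝓞 K), Bijective (inv (Sum.inr v))) : inv.IsPerfect := by
  intro v
  refine ⟨h v, fun M _ _ _ _ ρ hM => ?_⟩
  obtain ⟨inv₀, h₁, h₂⟩ := localTatePairingZMod_injective v ρ n hM
  obtain ⟨a, ha⟩ := AddMonoidHom.exists_eq_mul_of_bijective (inv (Sum.inr v)) inv₀ (h v)
  set P := DiscreteGaloisModule.localTatePairingZMod ρ n (Sum.inr v) (inv (Sum.inr v)) with hP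
  set P₀ := DiscreteGaloisModule.localTatePairingZMod ρ n (Sum.inr v) inv₀ with hP₀
  have hrel : ∀ x y, P₀ x y = P x y * a := fun x y => by
    rw [hP₀, hP, DiscreteGaloisModule.localTatePairingZMod_apply,
      DiscreteGaloisModule.localTatePairingZMod_apply, ha]
  have i₁ : Injective P := fun x₁ x₂ hx => h₁ (AddMonoidHom.ext fun y => by
    rw [hrel, hrel, hx])
  have i₂ : Injective P.flip := fun y₁ y₂ hy => h₂ (AddMonoidHom.ext fun x => by
    rw [AddMonoidHom.flip_apply, AddMonoidHom.flip_apply, hrel, hrel]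
    have := DFunLike.congr_fun hy x
    rw [AddMonoidHom.flip_apply, AddMonoidHom.flip_apply] at this
    rw [this])
  haveI := finite_galoisCohomology_one_toLocal ρ v
  haveI := finite_galoisCohomology_one_tateDual_toLocal ρ n v
  exact AddMonoidHom.bijective_of_injective_of_injective_flip
    (galoisCohomology.nsmul_eq_zero_of_forall _ hM)
    (galoisCohomology.nsmul_eq_zero_of_forall _ fun f =>
      DiscreteGaloisModule.TateDual.nsmul_eq_zero f) P i₁ i₂

end LocalInvariants

/-! ### The named fact from the reciprocity law of the Brauer group alone -/

/-- **Poitou–Tate (as vendored) from the Poitou–Tate VANISHING for a family of isomorphisms.**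
If for every `n ≥ 1` there is a family `inv` of local invariant maps, bijective at the finite
places, with `∑_v inv_v (loc_v x ∪ loc_v y) = 0` on global classes (`SumLocalTermEqZero`), then
`poitouTate_sum_localTatePairing_eq_zero K` holds — the local-duality conjunct being automatic
(`LocalInvariants.isPerfect_of_bijective`). [cite: MilneADT2006, Ch. I, Thm. 4.10(b) with Cor. 2.3] -/
theorem poitouTate_sum_localTatePairing_eq_zero_of_sumLocalTermEqZero
    (h : ∀ (n : ℕ) [NeZero n], ∃ inv : LocalInvariants K n,
      (∀ v : HeightOneSpectrum (𝓞 K), Bijective (inv (Sum.inr v))) ∧ inv.SumLocalTermEqZero) :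
    poitouTate_sum_localTatePairing_eq_zero K := by
  intro n _
  obtain ⟨inv, hbij, hsum⟩ := h n
  exact ⟨inv, inv.isPerfect_of_bijective hbij, hsum⟩

/-- **Poitou–Tate (as vendored) from the RECIPROCITY LAW OF THE BRAUER GROUP for a family of
isomorphisms.**  If for every `n ≥ 1` there is a family of local invariant maps
`inv_v : H²(K_v, μₙ) →+ ℤ/n`, bijective at the finite places, with `∑_{v ∈ S} inv_v (loc_v c) = 0`
for every global `c ∈ H²(K, μₙ)` and every finite `S` outside which the terms vanish
(`SumInvLocalizationEqZero`: the complex property of the Albert–Brauer–Hasse–Noether sequence on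
`Br(K)[n]`), then `poitouTate_sum_localTatePairing_eq_zero K` holds: the vanishing of the local
Tate pairings is the tree's `sumLocalTermEqZero_of_sumInvLocalizationEqZero` (localisation
commutes with cup products) and local duality is `LocalInvariants.isPerfect_of_bijective`.  This
isolates what remains to be proved of Milne I Thm. 4.10(b)/Cor. 2.3: ONE coherent normalisation of
the local invariant isomorphisms with `∑_v inv_v = 0` on global Brauer classes (global class field
theory), and nothing about local duality. [cite: MilneADT2006, Ch. I, Thm. 4.10(b) with Cor. 2.3]
[cite: Harari2020, Thm. 14.11 and Rem. 14.12] -/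
theorem poitouTate_sum_localTatePairing_eq_zero_of_sumInvLocalizationEqZero
    (h : ∀ (n : ℕ) [NeZero n], ∃ inv : LocalInvariants K n,
      (∀ v : HeightOneSpectrum (𝓞 K), Bijective (inv (Sum.inr v))) ∧
        inv.SumInvLocalizationEqZero) :
    poitouTate_sum_localTatePairing_eq_zero K :=
  poitouTate_sum_localTatePairing_eq_zero_of_sumLocalTermEqZero fun n _ =>
    let ⟨inv, hbij, hsum⟩ := h n
    ⟨inv, hbij, LocalInvariants.sumLocalTermEqZero_of_sumInvLocalizationEqZero inv hsum⟩

end Literature.NumberTheory.GaloisCohomology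

end
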